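import Summits.BirchSwinnertonDyer.BirchSwinnertonDyer.Theorems.ResidualThetaTransportAtTwoRlfTwistedCasselsOfLevel
import Summits.BirchSwinnertonDyer.BirchSwinnertonDyer.Theorems.ResidualThetaTransportAtTwoRlfTwistedLocalDescentAwayP
import HarnessLib

/-!
# (R6)-glue for road T of item 23110: (TCAS♯) from the level-`K` twisted Cassels statement (TCAS-K) ALONE, for ADMISSIBLE
# GENERATING local data — the local hypothesis (LOC-S₀) of `twistedCassels_sharp_of_level` discharged by the theorem (R4)

Route `ResidualThetaTransportAtTwo` (RTT, crux r201 `ResidualLambdaFormulaNegDiscAtTwo`, stmt-BirchSwinnertonDyer-23110) /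
`ThetaPartnerAtTwo` (TP2). Seat `prover-bsd-wall-tp2-p2x-w3` g12; `--supports stmt-BirchSwinnertonDyer-23110`. THEOREMS ONLY (no
definition, no named fact, no `sorry`); closes nothing.

The lead's `SignedEC.TwistedSurj.twistedCassels_sharp_of_level` (`…RlfTwistedCasselsOfLevel`, p-655xxx) displays two hypotheses:
(TCAS-K) `hlev` (Greenberg's Prop. 4.13 for `A_J = E[p^J](χ_u)` over `K`: research input (R5)) and (LOC-S₀) `hloc` (twisted local
`Γ`-descent at `v ∈ S₀`). The latter is the theorem `SignedEC.TwistedLocalDescent.exists_twistedTorsionToLocalH1_eq_of_zsmul_conjH1_eq`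
(`…RlfTwistedLocalDescentAwayP`, this seat) whenever the local datum `(N v, g v)` is ADMISSIBLE (`κ(g v|_{K̄}) = N v` — the door's
clause `γ^{N v} ∈ ker κ · g v|_{K̄}`, `apply_eq_ofAdd_of_pow_eq_mul`) and GENERATING (`κ(g v|_{K̄})` non-trivial of maximal norm on
`Γ_{K_v}`), at places `v ∤ p`. THIS FILE substitutes it:

* `twistedCassels_sharp_of_level_of_admissible` — (TCAS-K) at every level `J` + admissible generating `(N, g)` on `S₀ ∌ p`
  ⟹ (TCAS♯): every family of `p`-power-torsion twisted eigenvectors `(z_v)_{v ∈ S₀}` is `(loc_v c)` for a `ψ_u`-invariant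
  `c ∈ Sel♯_{S₀}(E/K_∞)` — the hypothesis `htwCas` of `rlf2_of_twistedDescent`. Any number field, prime, `ℤ_p`-extension with
  topological generator, sign, `u ≡ 1 (mod p)`.

What (R6) must still supply to reach the door's `hTL`: «`κ(D_v) = N_v ℤ₂`» for the cyclotomic `ℤ₂`-extension of `ℚ` and
`N_v = 2^{v₂((ℓ_v²−1)/8)}` (the generating clause), (TCAS-K) itself ((R5) + (R2)), and (LIFT⁺₂) ((R3)).
HONEST FRAMING: closes nothing; 23110 is NOT proved; BSD is not proved by any of this.
References: [GreenbergLNM1716] §4 Prop. 4.13 and Remark (pp. 122–124), proof of Lemma 4.7 (p. 108).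
-/

set_option autoImplicit false
set_option linter.dupNamespace false

noncomputable section

open scoped Classical NumberField

open NumberField IsDedekindDomain

namespace Summit.BirchSwinnertonDyer.BirchSwinnertonDyer.Theorems.SignedEC.TwistedLocalDescent

open Literature.NumberTheory.EllipticCurves Literature.NumberTheory.GaloisRepresentations
  WeierstrassCurve ZpExtension Literature.NumberTheory.EllipticCurves.Kobayashi2003
  Literature.NumberTheory.EllipticCurves.GreenbergVatsal2000

universe u

variable {K : Type u} [Field K] [NumberField K] (W : WeierstrassCurve K) [W.IsElliptic] (p : ℕ) [Fact p.Prime]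

/-- **(TCAS♯) ⟸ (TCAS-K), for admissible generating local data on `S₀ ∌ p`.** `K` a number field, `p` prime, `κ` a
`ℤ_p`-extension with topological generator `γ`, `ε` a sign, `S₀` a finite set of places NOT above `p`, `u ≡ 1 (mod p)`, and local
data `(N v, g v)` with `κ(g v|_{K̄}) = N v`, `g v|_{K̄} ∉ ker κ` and `κ(g v|_{K̄})` of maximal norm on `Γ_{K_v}` for `v ∈ S₀`. If for
every level `J` every family of local classes `t_v ∈ H¹(Γ_{K_v}, E[p^J](χ_u))` is `(res_v x)_{v ∈ S₀}` for some global `x` with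
`twistedTorsionToH1 x ∈ Sel♯_{S₀}` (TCAS-K), then every family of `p`-power-torsion twisted eigenvectors `(z_v)_{v ∈ S₀}`,
`u^{N v} · conj_{g v} z_v = z_v`, is `(loc_v c)` for some `c ∈ Sel♯_{S₀}(E/K_∞)` with `u · conj_γ c = c`. The local hypothesis of
`twistedCassels_sharp_of_level` is discharged by `exists_twistedTorsionToLocalH1_eq_of_zsmul_conjH1_eq`.
[cite: GreenbergLNM1716, §4 Prop. 4.13 Remark (p. 123), proof of Lemma 4.7 (p. 108), p. 124] -/
theorem twistedCassels_sharp_of_level_of_admissible (κ : ZpExtension K p) (ε : ℤˣ) {γ : Field.absoluteGaloisGroup K}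
    (hγ : κ.IsTopGenerator γ) (S₀ : Finset (HeightOneSpectrum (𝓞 K))) (hS₀ : ∀ v ∈ S₀, ((p : ℕ) : 𝓞 K) ∉ v.asIdeal)
    {u : ℤ} (hu : (p : ℤ) ∣ u - 1) (N : HeightOneSpectrum (𝓞 K) → ℕ)
    (g : ∀ v : HeightOneSpectrum (𝓞 K), Field.absoluteGaloisGroup (v.adicCompletion K))
    (hgN : ∀ v ∈ S₀, κ (resGal (K := K) (v.adicCompletion K) (g v)) = Multiplicative.ofAdd (N v : ℤ_[p]))
    (hg0 : ∀ v ∈ S₀, resGal (K := K) (v.adicCompletion K) (g v) ∉ κ.kerSubgroup)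
    (hmax : ∀ v ∈ S₀, ∀ σ : Field.absoluteGaloisGroup (v.adicCompletion K),
      ‖(κ (resGal (K := K) (v.adicCompletion K) σ)).toAdd‖ ≤ ‖(κ (resGal (K := K) (v.adicCompletion K) (g v))).toAdd‖)
    (hlev : ∀ (J : ℕ) (t : ∀ v : HeightOneSpectrum (𝓞 K),
        galoisCohomology ((W.twistedTorsionGaloisModule p κ J u hu).restrictField (v.adicCompletion K)) 1),
      ∃ x : galoisCohomology (W.twistedTorsionGaloisModule p κ J u hu) 1,
        W.twistedTorsionToH1 p κ J u hu x ∈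
            unramifiedOutside κ.kerSubgroup ↥(W.geomPrimaryTorsion p) p (↑S₀ : Set (HeightOneSpectrum (𝓞 K))) ⊓
              ⨅ (v : HeightOneSpectrum (𝓞 K)) (_ : ((p : ℕ) : 𝓞 K) ∈ v.asIdeal) (σ : Field.absoluteGaloisGroup K),
                (localKummerOverOfEmb W p κ.kerSubgroup (closureEmb (K := K) (v.adicCompletion K))
                  (⨆ n : ℕ, signedLocalPoints κ (v.adicCompletion K) W ε n)).comap (W.conjH1 p κ.kerSubgroup σ) ∧
          ∀ v ∈ S₀, galoisCohomology.res (W.twistedTorsionGaloisModule p κ J u hu) (v.adicCompletion K) 1 x = t v)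
    (z : ∀ v : HeightOneSpectrum (𝓞 K),
      discreteH1 (localSubgroup κ.kerSubgroup (v.adicCompletion K)) (localPoints W (v.adicCompletion K)))
    (hztor : ∀ v ∈ S₀, ∃ k : ℕ, p ^ k • z v = 0)
    (hzeig : ∀ v ∈ S₀, u ^ N v • Literature.NumberTheory.EllipticCurves.conjH1 (localSubgroup κ.kerSubgroup (v.adicCompletion K))
        (localPoints W (v.adicCompletion K)) (g v) (z v) = z v) :
    ∃ c ∈ unramifiedOutside κ.kerSubgroup ↥(W.geomPrimaryTorsion p) p (↑S₀ : Set (HeightOneSpectrum (𝓞 K))) ⊓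
        ⨅ (v : HeightOneSpectrum (𝓞 K)) (_ : ((p : ℕ) : 𝓞 K) ∈ v.asIdeal) (σ : Field.absoluteGaloisGroup K),
          (localKummerOverOfEmb W p κ.kerSubgroup (closureEmb (K := K) (v.adicCompletion K))
            (⨆ n : ℕ, signedLocalPoints κ (v.adicCompletion K) W ε n)).comap (W.conjH1 p κ.kerSubgroup σ),
      u • W.conjH1 p κ.kerSubgroup γ c = c ∧
        ∀ v ∈ S₀, W.localResOver p κ.kerSubgroup (v.adicCompletion K) c = z v :=
  TwistedSurj.twistedCassels_sharp_of_level W p κ ε hγ S₀ hu N g hlev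
    (fun v hv z' hz' heig' ↦ exists_twistedTorsionToLocalH1_eq_of_zsmul_conjH1_eq W κ hu v (hS₀ v hv) (hgN v hv) (hg0 v hv)
      (hmax v hv) z' hz' heig')
    z hztor hzeig

end Summit.BirchSwinnertonDyer.BirchSwinnertonDyer.Theorems.SignedEC.TwistedLocalDescent

end
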